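import Summits.AtomisticToContinuum.HydrodynamicLimit.Theorems.OneFlightGossipEngineEquilibriumClampedCollisionalWindowLDAdaptedClampKinematics
import Summits.AtomisticToContinuum.HydrodynamicLimit.Theorems.OneFlightGossipEngineEnergyCurrentTailsLevelCensusPreCollisionFlux

/-!
# Rungs R4 + R5 of line `Sketch` — the τ-uniform Gibbs mean of the total window transfer activity and the clamp deficit in the mean
# (crux `TwoClocks.ClampedTransferWindowLD`, stmt-AtomisticToContinuum-16623)

Helper file (`--supports stmt-AtomisticToContinuum-16623`) of the line lead, proving the registered stubs `SketchLine.stub_transferActivityMean` (R4)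
and `SketchLine.stub_overflowCount_mul_le` (R5, pointwise) and their corollary `lintegral_overflowCount_le`;
R4 of the lead-owned skeleton `Cruxes/ClampedTransferWindowLD/Lines/Sketch.lean` (v2): at small
reduced density (`SmallDensity uniformProfile σ`), for constant profiles `a₀, θ₀ > 0`, `u₀`, `N ≥ 1`, EVERY hard-sphere flow `Φ` and EVERY
`τ > 0`,

  `E_{G_N} [Σ_i act_i] ≤ 16 σ³ (N+1) · ∫ ‖w − v‖ · ‖v − w‖ (1 + ‖v + w‖/2) dN(u₀,θ₀)(v) dN(u₀,θ₀)(w)`,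

where `act_i = runAct σ τ Φ (window τ N) i = (σ/τ) Σ_{records of i in (0, w]} (‖Δv_i‖ + |Δ‖v_i‖²|/2)` is the window TRANSFER activity
of C′ (momentum + energy impulse). The bound is UNIFORM IN THE WINDOW LENGTH: the prefactor `σ/τ` of the activity exactly compensates
the linear growth of the collision flux in `w = τ (N+1)^{-1/3}` (`16 w (N+1)² ε_N² · σ/τ = 16 σ³ (N+1)`).

Proof: on a good orbit `Σ_i act_i = (σ/τ) Σ_{all records c in (0,w]} impulse c` (each record has one `fst`); the transfer impulse of a
record is at most `‖g‖ (1 + ‖v⁻ + v_*⁻‖/2)` in its INCOMING velocities (the velocity jump of an elastic reflection is radial and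
bounded by `‖g‖`, `AdaptedClampKinematics.norm_reflectVel_fst_sub_le`; the energy jump is `⟪v⁻ + v_*⁻, Δv⟫`,
`AdaptedClampKinematics.norm_sq_reflectVel_fst_sub`; `‖g‖` and `v + v_*` are collision invariants, `norm_snd_sub_fst_reflectVel`,
`reflectVel_fst_add_reflectVel_snd`); and the rung-0 collision-flux bound for incoming marks
`EnergyCurrentTailsLevelCensus.localGibbsLaw_lintegral_le_of_le_preCollisionMarkSum` (Cercignani–Illner–Pulvirenti 1994 App. 4.A) bounds
the Gibbs mean of such a collision sum by `16 w (N+1)² ε_N²` times the Gaussian flux integral of the mark.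

With rung R5 (`stub_overflowCount_mul_le`, pointwise `V · overflowCount ≤ Σ_i act_i`) this gives `E_G overflowCount ≤ 16 σ³ (N+1) I / V`
uniformly in `τ` — the V-uniform half of the tagged transfer-activity law (F2) in the mean (card `Ideas/clamp-price-static-shell.md`,
`StaticTransferActivityTail`, extensive form): the clamp deficit of C′ is `O(σ³/V)` per particle at every window length.
-/

noncomputable section

open MeasureTheory ProbabilityTheory Set Filter
open scoped ENNReal BigOperators
open Literature.Analysis.FluidPDE Literature.MathematicalPhysics.KineticTheory

namespace Summit.AtomisticToContinuum.HydrodynamicLimit.Theorems.ClampedTransferCoin.SketchLine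

/-! ## The transfer impulse of a record against the incoming flux mark -/

/-- The incoming flux mark `m(v, w) = ‖v − w‖ (1 + ‖v + w‖/2)` dominating the transfer impulse is continuous, hence measurable. -/
theorem measurable_impulseMark : Measurable fun p : V3 × V3 => ‖p.1 - p.2‖ * (1 + ‖p.1 + p.2‖ / 2) :=
  ((continuous_fst.sub continuous_snd).norm.mul
    (continuous_const.add ((continuous_fst.add continuous_snd).norm.div_const _))).measurable

/-- **The transfer impulse of an `ofConfig` record is at most the incoming mark**: `‖v⁺ − v⁻‖ + |‖v⁺‖² − ‖v⁻‖²|/2 ≤ ‖g⁻‖ (1 + ‖v⁻ + v_*⁻‖/2)`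
(radial velocity jump bounded by `‖g‖`; energy jump `= ⟪v + v_*, Δv⟫`; `‖g‖` and `v + v_*` are the same before and after). -/
theorem impulse_ofConfig_le_impulseMark {N : ℕ} (G : Geometry (Fin 3) T3) (ε : ℝ) (x : Phase N) (t : ℝ)
    (i j : Fin (N + 1)) :
    impulse (HardSphereCollisionRecord.ofConfig G ε x t i j) ≤
      ‖(HardSphereCollisionRecord.ofConfig G ε x t i j).preVel.1 - (HardSphereCollisionRecord.ofConfig G ε x t i j).preVel.2‖ *
        (1 + ‖(HardSphereCollisionRecord.ofConfig G ε x t i j).preVel.1 +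
          (HardSphereCollisionRecord.ofConfig G ε x t i j).preVel.2‖ / 2) := by
  set n : V3 := G.sepVec (x i).1 (x j).1 with hn
  set q : V3 × V3 := ((x i).2, (x j).2) with hq
  have hpre : (HardSphereCollisionRecord.ofConfig G ε x t i j).preVel = reflectVel n q := by
    simp [HardSphereCollisionRecord.ofConfig, hn, hq]
  have hpost : (HardSphereCollisionRecord.ofConfig G ε x t i j).postVel = q := by
    simp [HardSphereCollisionRecord.ofConfig, hq]
  -- the two collision invariants
  have hg : ‖(reflectVel n q).1 - (reflectVel n q).2‖ = ‖q.1 - q.2‖ := by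
    rw [← norm_neg, neg_sub, norm_snd_sub_fst_reflectVel, ← norm_neg, neg_sub]
  have hsum : (reflectVel n q).1 + (reflectVel n q).2 = q.1 + q.2 := reflectVel_fst_add_reflectVel_snd n q
  -- the two jumps
  have h1 : ‖q.1 - (reflectVel n q).1‖ ≤ ‖q.1 - q.2‖ := by
    rw [← norm_neg, neg_sub]; exact AdaptedClampKinematics.norm_reflectVel_fst_sub_le n q
  have h2 : |‖q.1‖ ^ 2 - ‖(reflectVel n q).1‖ ^ 2| / 2 ≤ ‖q.1 - q.2‖ * (‖q.1 + q.2‖ / 2) := by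
    have hid := AdaptedClampKinematics.norm_sq_reflectVel_fst_sub n q
    have habs : |‖q.1‖ ^ 2 - ‖(reflectVel n q).1‖ ^ 2| = |inner ℝ (q.1 + q.2) ((reflectVel n q).1 - q.1)| := by
      rw [← hid, abs_sub_comm]
    rw [habs]
    have hcs := abs_real_inner_le_norm (q.1 + q.2) ((reflectVel n q).1 - q.1)
    have h1' : ‖(reflectVel n q).1 - q.1‖ ≤ ‖q.1 - q.2‖ := AdaptedClampKinematics.norm_reflectVel_fst_sub_le n q
    have : |inner ℝ (q.1 + q.2) ((reflectVel n q).1 - q.1)| ≤ ‖q.1 + q.2‖ * ‖q.1 - q.2‖ :=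
      hcs.trans (mul_le_mul_of_nonneg_left h1' (norm_nonneg _))
    nlinarith [norm_nonneg (q.1 + q.2), norm_nonneg (q.1 - q.2)]
  unfold impulse
  rw [hpre, hpost, hg, hsum]
  nlinarith [h1, h2, norm_nonneg (q.1 - q.2), norm_nonneg (q.1 + q.2)]

/-! ## The total activity as one collision sum, and its domination on the good set -/

variable {σ : ℝ} {N : ℕ}

/-- On a good orbit, the TOTAL window transfer activity is `(σ/τ)` times the collision sum of the impulse over ALL records (each record
is counted once, under its first particle). -/
theorem sum_runAct_eq (Φ : Flow σ N) (τ t : ℝ) {z : Phase N} (hz : z ∈ Φ.good) :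
    ∑ i, runAct σ τ Φ t i z = σ / τ * Φ.collisionSum (Ioc 0 t) impulse z := by
  classical
  unfold runAct
  rw [← Finset.mul_sum]
  congr 1
  have hfin := Φ.finite_collisionTimes_inter hz (S := Ioc 0 t) Ioc_subset_Icc_self
  simp only [HardSphereFlow.collisionSum_eq, collisionSum_eq_finset_sum hfin]
  rw [Finset.sum_comm]
  refine Finset.sum_congr rfl fun s _ => ?_
  rw [Finset.sum_comm]
  refine Finset.sum_congr rfl fun p _ => ?_
  simp only [HardSphereCollisionRecord.ofConfig_fst, Finset.sum_ite_eq, Finset.mem_univ, if_true]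

/-- **Domination on the good set**: `ofReal (Σ_i act_i z) ≤ Σ_{records c in (0,w]} ofReal ((σ/τ) · m(c.preVel))` along the orbit of
`Φ_0 z = z`. -/
theorem ofReal_sum_runAct_le (Φ : Flow σ N) {τ : ℝ} (hστ : 0 ≤ σ / τ) (t : ℝ) {z : Phase N} (hz : z ∈ Φ.good) :
    ENNReal.ofReal (∑ i, runAct σ τ Φ t i z) ≤
      Φ.collisionSum (Ioc 0 t)
        (fun c => ENNReal.ofReal (σ / τ * (‖c.preVel.1 - c.preVel.2‖ * (1 + ‖c.preVel.1 + c.preVel.2‖ / 2)))) (Φ.flow 0 z) := by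
  classical
  rw [Φ.flow_zero z hz, sum_runAct_eq Φ τ t hz]
  have hfin := Φ.finite_collisionTimes_inter hz (S := Ioc 0 t) Ioc_subset_Icc_self
  simp only [HardSphereFlow.collisionSum_eq, collisionSum_eq_finset_sum hfin]
  rw [Finset.mul_sum, ENNReal.ofReal_sum_of_nonneg fun s _ =>
    mul_nonneg hστ (Finset.sum_nonneg fun p _ => AdaptedClampKinematics.impulse_nonneg _)]
  refine Finset.sum_le_sum fun s _ => ?_
  rw [Finset.mul_sum, ENNReal.ofReal_sum_of_nonneg fun p _ => mul_nonneg hστ (AdaptedClampKinematics.impulse_nonneg _)]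
  refine Finset.sum_le_sum fun p _ => ENNReal.ofReal_le_ofReal ?_
  exact mul_le_mul_of_nonneg_left (impulse_ofConfig_le_impulseMark _ _ _ _ _ _) hστ

/-! ## The window algebra `16 w (N+1)² ε_N² · σ/τ = 16 σ³ (N+1)` -/

/-- `16 w (N+1)² ε_N² · (σ/τ) = 16 σ³ (N+1)` for `τ ≠ 0` (`w = τ (N+1)^{-1/3}`, `ε_N = σ (N+1)^{-1/3}`, `((N+1)^{-1/3})³ = (N+1)⁻¹`). -/
theorem window_flux_const (σ : ℝ) {τ : ℝ} (hτ : τ ≠ 0) (N : ℕ) :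
    16 * window τ N * ((N + 1 : ℕ) : ℝ) ^ 2 * hsDiameter σ N ^ 2 * (σ / τ) = 16 * σ ^ 3 * ((N : ℝ) + 1) := by
  have hN : (0 : ℝ) < (N : ℝ) + 1 := by positivity
  set r : ℝ := ((N : ℝ) + 1) ^ (-(1 / 3 : ℝ)) with hr
  have hr3 : r ^ 3 = ((N : ℝ) + 1)⁻¹ := by
    rw [hr, ← Real.rpow_mul_natCast hN.le]
    norm_num [Real.rpow_neg_one]
  have hw : window τ N = τ * r := rfl
  have hε : hsDiameter σ N = σ * r := by
    unfold hsDiameter; push_cast; rfl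
  have hc : ((N + 1 : ℕ) : ℝ) = (N : ℝ) + 1 := by push_cast; ring
  rw [hw, hε, hc]
  have key : ((N : ℝ) + 1) ^ 2 * r ^ 3 = (N : ℝ) + 1 := by
    rw [hr3, pow_two, mul_assoc, mul_inv_cancel₀ hN.ne', mul_one]
  calc 16 * (τ * r) * ((N : ℝ) + 1) ^ 2 * (σ * r) ^ 2 * (σ / τ)
      = 16 * σ ^ 3 * (((N : ℝ) + 1) ^ 2 * r ^ 3) * (τ / τ) := by ring
    _ = 16 * σ ^ 3 * ((N : ℝ) + 1) := by rw [key, div_self hτ, mul_one]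

/-! ## R4 -/

/-- **R4 · τ-uniform Gibbs mean of the total transfer activity** (registered stub of line `Sketch`, v2): at small reduced density, for
constant profiles `a₀, θ₀ > 0`, `u₀`, `N ≥ 1`, every flow `Φ` and every `τ > 0`,
`E_G[Σ_i act_i] ≤ 16 σ³ (N+1) · ∫ ‖w − v‖ · ‖v − w‖ (1 + ‖v + w‖/2) dN(u₀,θ₀)^{⊗2}(v, w)` — uniformly in the window length. -/
theorem stub_transferActivityMean :
    ∀ {σ : ℝ}, SmallDensity uniformProfile σ → ∀ (a₀ θ₀ : ℝ) (u₀ : V3), 0 < a₀ → 0 < θ₀ → ∀ {N : ℕ}, 1 ≤ N →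
      ∀ (Φ : Flow σ N) (τ : ℝ), 0 < τ →
        ∫⁻ z, ENNReal.ofReal (∑ i, runAct σ τ Φ (window τ N) i z) ∂(gibbs σ a₀ θ₀ u₀ N Φ) ≤
          ENNReal.ofReal (16 * σ ^ 3 * ((N : ℝ) + 1)) *
            ∫⁻ p, ENNReal.ofReal (‖p.2 - p.1‖ * (‖p.1 - p.2‖ * (1 + ‖p.1 + p.2‖ / 2)))
              ∂((gaussMeasure u₀ θ₀).prod (gaussMeasure u₀ θ₀)) := by
  intro σ hsm a₀ θ₀ u₀ ha hθ N hN Φ τ hτ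
  have hσ : 0 < σ := hsm.σ_pos
  have hστ : 0 ≤ σ / τ := div_nonneg hσ.le hτ.le
  have hw : 0 < window τ N := window_pos hτ N
  -- the incoming mark, with the activity normalisation inside
  set A : V3 × V3 → ℝ≥0∞ := fun p => ENNReal.ofReal (σ / τ * (‖p.1 - p.2‖ * (1 + ‖p.1 + p.2‖ / 2))) with hA
  have hAm : Measurable A := (measurable_impulseMark.const_mul _).ennreal_ofReal
  have hdom : ∀ z ∈ Φ.good, ENNReal.ofReal (∑ i, runAct σ τ Φ (window τ N) i z) ≤
      Φ.collisionSum (Ioc 0 (window τ N)) (fun c => A c.preVel) (Φ.flow 0 z) :=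
    fun z hz => ofReal_sum_runAct_le Φ hστ (window τ N) hz
  have h := EnergyCurrentTailsLevelCensus.localGibbsLaw_lintegral_le_of_le_preCollisionMarkSum hsm ha hθ u₀ hN Φ hw
    hAm 0 hdom
  refine h.trans (le_of_eq ?_)
  -- constants: pull `σ/τ` out of the flux integral and use the window algebra
  have hI : ∫⁻ p, ENNReal.ofReal ‖p.2 - p.1‖ * A p ∂((gaussMeasure u₀ θ₀).prod (gaussMeasure u₀ θ₀)) =
      ENNReal.ofReal (σ / τ) * ∫⁻ p, ENNReal.ofReal (‖p.2 - p.1‖ * (‖p.1 - p.2‖ * (1 + ‖p.1 + p.2‖ / 2)))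
        ∂((gaussMeasure u₀ θ₀).prod (gaussMeasure u₀ θ₀)) := by
    rw [← lintegral_const_mul' _ _ ENNReal.ofReal_ne_top]
    refine lintegral_congr fun p => ?_
    rw [hA, ← ENNReal.ofReal_mul (norm_nonneg _), ← ENNReal.ofReal_mul hστ]
    congr 1
    ring
  rw [hI, ← mul_assoc, ← ENNReal.ofReal_mul (by positivity)]
  congr 2
  have := window_flux_const σ hτ.ne' N
  linear_combination this


/-! ## R5 and the clamp-deficit mean bound -/

/-- The window transfer activity of a particle is nonnegative (for `σ/τ ≥ 0`), at EVERY datum (no good-set hypothesis: the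
collision sum of a nonnegative record functional is a `finsum` of nonnegative terms). -/
theorem runAct_nonneg {σ τ : ℝ} (hστ : 0 ≤ σ / τ) {N : ℕ} (Φ : Flow σ N) (t : ℝ) (i : Fin (N + 1)) (z : Phase N) :
    0 ≤ runAct σ τ Φ t i z := by
  unfold runAct
  refine mul_nonneg hστ ?_
  rw [HardSphereFlow.collisionSum_eq, collisionSum_eq_collisionPairSum]
  exact collisionPairSum_nonneg fun _ _ _ => AdaptedClampKinematics.ite_impulse_nonneg _ _

/-- **R5 · the overflow count against the total activity** (registered stub of line `Sketch`, v2; pointwise, every datum): for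
`σ/τ ≥ 0` and `V > 0`, `V · #{i : act_i > V} ≤ Σ_i act_i`. -/
theorem stub_overflowCount_mul_le :
    ∀ (σ τ V : ℝ) {N : ℕ} (Φ : Flow σ N) (z : Phase N), 0 ≤ σ / τ → 0 < V →
      V * (overflowCount σ τ V Φ z : ℝ) ≤ ∑ i, runAct σ τ Φ (window τ N) i z := by
  intro σ τ V N Φ z hστ _hV
  classical
  unfold overflowCount
  set S := Finset.univ.filter fun i => V < runAct σ τ Φ (window τ N) i z with hS
  calc V * (S.card : ℝ) = ∑ _i ∈ S, V := by rw [Finset.sum_const, nsmul_eq_mul, mul_comm]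
    _ ≤ ∑ i ∈ S, runAct σ τ Φ (window τ N) i z :=
        Finset.sum_le_sum fun i hi => ((Finset.mem_filter.1 hi).2).le
    _ ≤ ∑ i, runAct σ τ Φ (window τ N) i z :=
        Finset.sum_le_sum_of_subset_of_nonneg (Finset.filter_subset _ _) fun i _ _ =>
          runAct_nonneg hστ Φ _ i z


/-- **The clamp deficit in the mean, uniformly in the window length**: at small reduced density, for constant profiles, `N ≥ 1`, every
flow, every `τ > 0` and every clamp level `V > 0`,
`E_G #{i : act_i > V} ≤ V⁻¹ · 16 σ³ (N+1) · ∫ ‖w − v‖ · ‖v − w‖ (1 + ‖v + w‖/2) dN(u₀,θ₀)^{⊗2}` (R5 pointwise, then R4). In particular the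
expected clamped FRACTION is `O(σ³/V)` at every window length (the V-uniform half of (F2) in the mean; `V₀` of C′ exists quantitatively). -/
theorem lintegral_overflowCount_le {σ : ℝ} (hsm : SmallDensity uniformProfile σ) (a₀ θ₀ : ℝ) (u₀ : V3) (ha : 0 < a₀)
    (hθ : 0 < θ₀) {N : ℕ} (hN : 1 ≤ N) (Φ : Flow σ N) {τ : ℝ} (hτ : 0 < τ) {V : ℝ} (hV : 0 < V) :
    ∫⁻ z, ((overflowCount σ τ V Φ z : ℕ) : ℝ≥0∞) ∂(gibbs σ a₀ θ₀ u₀ N Φ) ≤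
      (ENNReal.ofReal V)⁻¹ * (ENNReal.ofReal (16 * σ ^ 3 * ((N : ℝ) + 1)) *
        ∫⁻ p, ENNReal.ofReal (‖p.2 - p.1‖ * (‖p.1 - p.2‖ * (1 + ‖p.1 + p.2‖ / 2)))
          ∂((gaussMeasure u₀ θ₀).prod (gaussMeasure u₀ θ₀))) := by
  have hστ : 0 ≤ σ / τ := div_nonneg hsm.σ_pos.le hτ.le
  have hV' : ENNReal.ofReal V ≠ 0 := (ENNReal.ofReal_pos.2 hV).ne'
  -- pointwise: `overflowCount ≤ V⁻¹ · Σ_i act_i`, in `ℝ≥0∞`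
  have hpt : ∀ z, ((overflowCount σ τ V Φ z : ℕ) : ℝ≥0∞) ≤
      (ENNReal.ofReal V)⁻¹ * ENNReal.ofReal (∑ i, runAct σ τ Φ (window τ N) i z) := by
    intro z
    have h := stub_overflowCount_mul_le σ τ V Φ z hστ hV
    have h' : ((overflowCount σ τ V Φ z : ℕ) : ℝ≥0∞) = ENNReal.ofReal (overflowCount σ τ V Φ z : ℝ) := by
      rw [ENNReal.ofReal_natCast]
    rw [h', ← ENNReal.mul_le_iff_le_inv hV' ENNReal.ofReal_ne_top, ← ENNReal.ofReal_mul hV.le]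
    exact ENNReal.ofReal_le_ofReal h
  calc ∫⁻ z, ((overflowCount σ τ V Φ z : ℕ) : ℝ≥0∞) ∂(gibbs σ a₀ θ₀ u₀ N Φ)
      ≤ ∫⁻ z, (ENNReal.ofReal V)⁻¹ * ENNReal.ofReal (∑ i, runAct σ τ Φ (window τ N) i z) ∂(gibbs σ a₀ θ₀ u₀ N Φ) :=
        lintegral_mono hpt
    _ = (ENNReal.ofReal V)⁻¹ * ∫⁻ z, ENNReal.ofReal (∑ i, runAct σ τ Φ (window τ N) i z) ∂(gibbs σ a₀ θ₀ u₀ N Φ) :=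
        lintegral_const_mul' _ _ (ENNReal.inv_ne_top.2 hV')
    _ ≤ _ := by gcongr; exact stub_transferActivityMean hsm a₀ θ₀ u₀ ha hθ hN Φ τ hτ

end Summit.AtomisticToContinuum.HydrodynamicLimit.Theorems.ClampedTransferCoin.SketchLine

end
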